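import Literature.AnabelianGeometry.EtaleTheta.Discharge.Sec5ThetaSubquotientProjGaloisPinnedLevelN

/-!
# [EtTh] §5 p.327: the PINNED v2 subquotient term at the level-`N` data as a NAMED constant (`pinnedLevelStub`) with its
# pin / coverage / hlift laws — class (b) packaging of my ∃-form `exists_thetaSubquotientProjGalois_pinned_levelStub` (p489319)

Mochizuki, *The étale theta function and its Frobenioid-theoretic manifestations*, Publ. RIMS **45** (2009), §5 p. 327 (PDF p. 101)
«these subquotients determine subquotients `Aut_D(D) ↠ Aut^Θ_D(D)`; `(l·Δ_Θ)_D ⊆ Aut^Θ_D(D)`» [cite: MochizukiEtTh2009, §5 p.327 (PDF p.101)].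
abc-iut cell, layer L2, seat abc-iut-w5-d051 (gen 6); ONE definition (`Classical.choose` of my ∃-form — axioms stay {propext, Classical.choice, Quot.sound}) + its laws; nothing landed is
edited or restated.  WHY: consumers of the pinned term (the Thm. 5.6 top knot «P-elimination at 𝔉_N», the (w4-S) end-knit spine, the Thm. 5.7
hK4fam knit) otherwise destructure an `∃` inside every proof; a NAMED term lets their STATEMENTS mention print's constructed subquotient directly.

* `ThetaFrobenioid.pinnedLevelStub …` : `ThetaSubquotientProjGalois 𝔉_N (IsGaloisObj ·.obj)` at `𝔉_N := ofConnectedTemperoidData h (RD.levelStub ιX) …` —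
  `pre F := (autPre q_N ι_N F.obj).comap (mapAut F ι)`, `proj F := autProj q_N ι_N F.obj ∘ mapAut` (abc-iut-w6-d079's construction p486065 at
  `(q, ι) := (q_N, ι_N)`; onto at Galois objects by `autProj_surjective_at_galoisObj` + `qN_surjective`);
* `pinnedLevelStub_pre` = abc-iut-w4-d042's pin `hPpre` at every object (spec lemma, `rw`); `pinnedLevelStub_proj_pin` = the cast-free pin `hPproj_pin` at every object;
* `lDeltaCoveredGal_pinnedLevelStub` — coverage `Thm56Sub.LDeltaCoveredGal 𝔉_N (pinnedLevelStub …)` (my p487842 fed the pins), no hypothesis;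
* `hlift_pinnedLevelStub` — the (C)-junction hlift law for it under abc-iut-w4-d042's `hH`.
USAGE (measured): write every application WITH EXPLICIT UNIVERSES — `pinnedLevelStub.{u₀, v₀, w'} h odd_l …`, `pinnedLevelStub_pre.{u₀, v₀, w'} …` —
and feed level-`N` pieces through closed-type `have` steps (abc-iut-L2-t9's device); without the universe annotations statement elaboration at this
carrier exceeds the default heartbeat limit.  The pins are propositional (`rw`/`▸`), not `rfl`, by design.
HONEST FRAMING: packaging of the cell's own typed records at an abstract carrier (`tf`, `RD`, `R` abstract); nothing asserts that [EtTh]'s data exist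
for an actual curve; [EtTh] is refereed; no side taken on [IUTchIII] Cor. 3.12; typed ≠ proved; nothing here asserts abc proved or refuted.
-/

noncomputable section

namespace Literature.AnabelianGeometry.EtaleTheta

open CategoryTheory Opposite FrobenioidCyclotomicRigidity Literature.AlgebraicGeometry.Frobenioids
  Literature.AnabelianGeometry.SemiGraphs Literature.AnabelianGeometry.SemiGraphs.GaloisObjects
open Literature.AlgebraicGeometry.Frobenioids.QuasiTemperoid (stabilizerSubgroup)

universe u₀ v₀ w'

namespace ThetaFrobenioid

open ThetaSubquotient
open FrobenioidCyclotomicRigidity (ThetaSubquotientProjGalois)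

section LevelN

variable {K : Type u₀} [Field K] {X : SemiGraphs.TemperedArithmeticGroup.{u₀} K} {D₀ : Type u₀} [Category.{v₀} D₀]
  {V : FrdIMonoidStub.{max u₀ w'}} {T₀ : RealifiedDivisorMonoids (D₀ := D₀) V}
  {VD : FrdICatStub.{u₀ + 1, u₀, max u₀ w'} (ConnectedPart (BTemp X.Pi))}
  {tf : TemperedFrobenioid T₀ (ConnectedPart (BTemp X.Pi)) VD} {hZ : tf.monoidType = MonoidType.Z}
  {hP : ∀ A : (ConnectedPart (BTemp X.Pi))ᵒᵖ, IsPerfect (tf.Φ.carrier A)}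
  {NH : Subgroup (Field.absoluteGaloisGroup K) → tf.category → ℕ+ → Prop} {A₀ : tf.category}
  {hA₀ : PreFrobenioid.IsFrobeniusTrivial tf.toElem A₀} {hA₀' : SemiGraphs.IsGaloisObj A₀.base.obj}
  {lv N : ℕ+} {l' : ℕ} {RD : RigidData.{max u₀ w'} N l'}
  {pullFrac : ∀ {A A' : (BiKummerSetting.mkOfConnectedTemperoid X tf hZ hP NH A₀ hA₀ hA₀').C} (_ : A' ⟶ A),
    (BiKummerSetting.mkOfConnectedTemperoid X tf hZ hP NH A₀ hA₀ hA₀').biratUnits A →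
      (BiKummerSetting.mkOfConnectedTemperoid X tf hZ hP NH A₀ hA₀ hA₀').biratUnits A'}
  {θ : (BiKummerSetting.mkOfConnectedTemperoid X tf hZ hP NH A₀ hA₀ hA₀').biratUnits
    (BiKummerSetting.mkOfConnectedTemperoid X tf hZ hP NH A₀ hA₀ hA₀').Aodot}
  {Bl : (BiKummerSetting.mkOfConnectedTemperoid X tf hZ hP NH A₀ hA₀ hA₀').C}
  {Pl : (BiKummerSetting.mkOfConnectedTemperoid X tf hZ hP NH A₀ hA₀ hA₀').FractionPair θ Bl}
  {Rl : (BiKummerSetting.mkOfConnectedTemperoid X tf hZ hP NH A₀ hA₀ hA₀').NthRoot θ Pl lv pullFrac}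
  (h : ModelFrobenioid.Hypotheses tf.divisorMonoid tf.ratFnFunctor)
  (odd_l : Odd (lv : ℕ))
  (R : (BiKummerSetting.mkOfConnectedTemperoid X tf hZ hP NH A₀ hA₀ hA₀').NthRoot Rl.root Rl.pair N pullFrac)
  (ιX : RD.PiX ≃ₜ* X.Pi) (K' : Type (max u₀ w')) [Field K'] (constEmb : K'ˣ →* tf.biratUnitsModel R.BN)
  (constEmb_injective : Function.Injective constEmb)
  (hinvc : ∀ g : Aut R.AN.base,
    pull tf.divisorMonoid g.hom (ModelFrobenioid.div R.pair.num) = ModelFrobenioid.div R.pair.num)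
  (hinvp : ∀ y : RD.PiX, y ∈ RD.PiYdd →
    pull tf.divisorMonoid ((BiKummerSetting.mkOfConnectedTemperoid X tf hZ hP NH A₀ hA₀ hA₀').galoisSurj R.AN.base
      R.αData.isGalois (ιX y)).hom (ModelFrobenioid.div R.pair.den) = ModelFrobenioid.div R.pair.den)
  [RD.iotaN.range.Normal]

/-- **Print's constructed subquotient at the level-`N` data, as a NAMED term of the v2 record** — the witness of my
`exists_thetaSubquotientProjGalois_pinned_levelStub` (p489319: `pre F := (autPre q_N ι_N F.obj).comap (mapAut F ι)`, `proj F := autProj q_N ι_N F.obj ∘ mapAut`,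
onto at Galois objects), chosen once (`Classical.choose`; its two pin laws are the `_pre` / `_proj_pin` spec lemmas below, propositional — consumers
`rw` with them).  [cite: MochizukiEtTh2009, §5 p.327 (PDF p.101)] -/
noncomputable def pinnedLevelStub : ThetaSubquotientProjGalois (ofConnectedTemperoidData h (RD.levelStub ιX) odd_l R ιX K' constEmb constEmb_injective hinvc hinvp)
    fun E => IsGaloisObj E.obj :=
  Classical.choose (exists_thetaSubquotientProjGalois_pinned_levelStub.{u₀, v₀, w'} h odd_l R ιX K' constEmb constEmb_injective hinvc hinvp)

/-- abc-iut-w4-d042's pin `hPpre` for the named term, at every object (spec lemma). [cite: MochizukiEtTh2009, §5 p.327 (PDF p.101)] -/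
theorem pinnedLevelStub_pre (F : ConnectedPart (BTemp X.Pi)) :
    (pinnedLevelStub.{u₀, v₀, w'} h odd_l R ιX K' constEmb constEmb_injective hinvc hinvp).pre F =
      (autPre (RD.qN ιX) RD.iotaN F.obj).comap (Functor.mapAut F (connectedObjects (BTemp X.Pi)).ι) :=
  (Classical.choose_spec (exists_thetaSubquotientProjGalois_pinned_levelStub.{u₀, v₀, w'} h odd_l R ιX K' constEmb constEmb_injective hinvc hinvp)).1 F

/-- abc-iut-w4-d042's cast-free pin `hPproj_pin` for the named term, at every object (spec lemma). [cite: MochizukiEtTh2009, §5 p.327 (PDF p.101)] -/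
theorem pinnedLevelStub_proj_pin (F : ConnectedPart (BTemp X.Pi))
    (σ : (pinnedLevelStub.{u₀, v₀, w'} h odd_l R ιX K' constEmb constEmb_injective hinvc hinvp).pre F) (τ : autPre (RD.qN ιX) RD.iotaN F.obj)
    (hστ : Functor.mapAut F (connectedObjects (BTemp X.Pi)).ι σ.1 = τ.1) :
    ((pinnedLevelStub.{u₀, v₀, w'} h odd_l R ιX K' constEmb constEmb_injective hinvc hinvp).proj F σ : LDelta (RD.qN ιX) RD.iotaN F.obj) =
      autProj (RD.qN ιX) RD.iotaN F.obj τ :=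
  (Classical.choose_spec (exists_thetaSubquotientProjGalois_pinned_levelStub.{u₀, v₀, w'} h odd_l R ιX K' constEmb constEmb_injective hinvc hinvp)).2 F σ τ hστ

/-- **Coverage holds for the named pinned term** (`Thm56Sub.LDeltaCoveredGal`), no hypothesis — my `lDeltaCovered_levelStub_of_pins_galois`
(p487842) fed the two pins.  [cite: MochizukiEtTh2009, Prop 5.5 proof p.327–328 (PDF pp.101–102); §1 p.238 (PDF p.12)] -/
theorem lDeltaCoveredGal_pinnedLevelStub :
    Thm56Sub.LDeltaCoveredGal (ofConnectedTemperoidData h (RD.levelStub ιX) odd_l R ιX K' constEmb constEmb_injective hinvc hinvp) (pinnedLevelStub.{u₀, v₀, w'} h odd_l R ιX K' constEmb constEmb_injective hinvc hinvp) := by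
  have hcov := lDeltaCovered_levelStub_of_pins_galois.{u₀, v₀, w'} h odd_l R ιX K' constEmb constEmb_injective hinvc hinvp
    (pinnedLevelStub.{u₀, v₀, w'} h odd_l R ιX K' constEmb constEmb_injective hinvc hinvp) (pinnedLevelStub_pre.{u₀, v₀, w'} h odd_l R ιX K' constEmb
      constEmb_injective hinvc hinvp R.BN.base) (pinnedLevelStub_proj_pin.{u₀, v₀, w'} h odd_l R ιX K' constEmb constEmb_injective hinvc hinvp R.BN.base)
  exact hcov

/-- **The (C)-junction hlift law for the named pinned term** under abc-iut-w4-d042's `hH` («`ιX⁻¹(Stab x) ≤ Π^tp_Ÿ`»).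
[cite: MochizukiEtTh2009, §5 p.330 (PDF p.104)] -/
theorem hlift_pinnedLevelStub
    (hH : (stabilizerSubgroup R.BN.base.obj ((BiKummerSetting.NthRoot.baseIso _ R).hom.hom.hom.hom
        (galoisBase X.isTempered R.AN.base.obj R.αData.isGalois))).comap ιX.toMonoidHom ≤ RD.PiYdd)
    (k : RD.PiYdd) (hk : rhoOfBiKummerData R ιX k ∈ (pinnedLevelStub.{u₀, v₀, w'} h odd_l R ιX K' constEmb constEmb_injective hinvc hinvp).pre R.BN.base) :
    ∃ k₁ : RD.PiYdd, ((MulEquiv.refl RD.PiX) k₁ : RD.PiX) ∈ RD.lDeltaTheta ∧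
      rhoOfBiKummerData R ιX k₁ = rhoOfBiKummerData R ιX k := by
  have hlift := hlift_levelStub_of_pin_galois.{u₀, v₀, w'} h odd_l R ιX K' constEmb constEmb_injective hinvc hinvp
    (pinnedLevelStub.{u₀, v₀, w'} h odd_l R ιX K' constEmb constEmb_injective hinvc hinvp) (pinnedLevelStub_pre.{u₀, v₀, w'} h odd_l R ιX K' constEmb
      constEmb_injective hinvc hinvp R.BN.base) hH k hk
  exact hlift

end LevelN

end ThetaFrobenioid

end Literature.AnabelianGeometry.EtaleTheta

end
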